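/-
Copyright (c) 2026 the pub-hodgecm-mathlib formalisation cell (harness21).  Prover seat hodgecm-mathlib-B-p08 (g40): LH4-plan (g6) WORD #72 — M6 memo §4 row «`…TypeTwoDischarged`
(W-odd)»: the type-(2) side conditions WITHOUT `|2| = 1` (memo `B-provers/B-p08/g40/MEMO-M6-EP-wild.v1.B-p08g40.md` §0 table, §1 (iii)); 2026-09-02.
-/
import Literature.NumberTheory.Automorphic.UnitaryTwoEulerPoincareEllipticTypeTwoDischarged   -- ★ B-p08 (g28): `valuation_det_eq_one_of_mem`, the `Valued`∕`ValuativeRel` bridge, the one-place tokens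
import Literature.NumberTheory.LocalFields.CompleteValuedSquareRootNearOne                   -- ★ LH5-p03: `exists_mul_self_eq_of_valued_sub_one_lt_four_adicCompletion` (strong Hensel at radius `|4|`)
import HarnessLib

/-!
# The type-(2) side conditions at ANY residue characteristic: integral trace from rootlessness, and the odd `|disc ∕ 4|` at the odd-discriminant rows

Topic `NumberTheory/Automorphic`; namespace `Literature.NumberTheory.Automorphic` (§1) ∕ `….UnitaryGroup` (§2).  THEOREMS ONLY (no definition, no instance, no notation,
no named fact, no `sorry`); kernel lane `--supports stmt-HodgeConjecture-24833`.  Cell `pub/hodgecm-mathlib` (D-0151), crux H413 = `stmt-HodgeConjecture-24833`; half A line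
LH4 (dyadic pay-down), LH4-plan (g6) price list WORD #40∕#72, M6 memo (B-p08 (g40), FINDING #5) §4 row «`…TypeTwoDischarged` (W-odd)»: the DYADIC twin of
★ `UnitaryTwoEulerPoincareEllipticTypeTwoDischarged` §1–§2, whose two uses of `|2|_w = 1` are (memo §1 (iii)): (a) `valuation_trace_le_one_of_not_exists_isRoot (h2)` —
Hensel at radius `1` for `x = 1 − 4 det∕tr²`; (b) `typeTwo_sideConditions_of_not_exists_isRoot (h2)` — «rootless ⇒ `|tr² − 4det|` ODD», true only in the tame row (at a wild
UNIT-discriminant row `ord_w(tr² − 4det) = 2j + 2(e − k)` is even).  HONEST LABEL: HC_CM is proved only modulo the 7 printed citations (2 remaining named inputs: hLiu418 =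
stmt-HodgeConjecture-24832, h413 = stmt-HodgeConjecture-24833) until rung 0 closes; this file is count-neutral base layer (pays no organ, opens no road).

* §1 **`valued_trace_le_one_of_not_exists_isRoot_adicCompletion`** (completion `K_w` of a number field at ANY finite place; `Valued` currency) and its `ValuativeRel`
  reading **`valuation_trace_le_one_of_not_exists_isRoot_adicCompletion`**: `|det g| ≤ 1`, `χ_g` rootless ⇒ `|tr g| ≤ 1` — if `|tr| > 1` then `x = 1 − 4det∕tr²` has
  `|x − 1| = |4|·|det|∕|tr|² < |4|`, so `x = s²` by the STRONG Hensel square-root lemma ★ `exists_mul_self_eq_of_valued_sub_one_lt_four_adicCompletion` (every residue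
  characteristic), and `(tr + tr·s)∕2` is a root of `X² − tr·X + det`.  [Serre1979, Ch. XIV §4 + Ch. II §4 Prop. 7]
* §2 **`typeTwo_sideConditions_of_not_exists_isRoot_of_odd`** (CM one-place frame of ★ (R5c″), NO `|2|` binder, NO `hunr`): for `γ ∈ U₂` with `χ_{γ,w}` rootless and
  `|tr² − 4det|_w = exp(2m+1)` ODD (rows (T) and (W-odd)): `tr γ_w ∈ 𝒪_w` and `∃ N : ℕ, |(tr² − 4det)∕4|_w = exp(−(2N+1))` — the radius `N = j(γ)` of the fixed ball
  (memo §0 table: reading `N` from `disc∕4` instead of `disc` is what makes the tame letters row-blind on (T) ∪ (W-odd)).  Proof: `|det| = 1` (★ `valuation_det_eq_one_of_mem`),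
  `|tr| ≤ 1` (§1); `|tr²|` and `|4det| = |4|` are EVEN powers, so an odd `|tr² − 4det|` forces `|tr²| = |4|` and `|tr² − 4det| < |4|`, i.e. `|disc∕4| < 1` of odd order.

## References
* [Serre1979] J.-P. Serre, *Local Fields*, GTM 67 (1979): Ch. II §4 Prop. 7 (Hensel), Ch. XIV §4 (squares among one-units).
* [Kottwitz1988] R. E. Kottwitz, *Tamagawa numbers*, Ann. of Math. 127 (1988), 629–646, §2 (the type-(2) elliptic classes on the tree of `U(1,1)`).
* [Rogawski1990] J. D. Rogawski, *Automorphic Representations of Unitary Groups in Three Variables* (1990), §3.6 p. 31 (the anisotropic tori `(EK)¹`).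
* [Omeara1963] O. T. O'Meara, *Introduction to Quadratic Forms* (1963), §63A (dyadic unit square classes).
-/

set_option autoImplicit false

noncomputable section

open scoped ValuativeRel Matrix MatrixGroups
open Matrix ValuativeRel NumberField IsDedekindDomain MulAction Polynomial WithZero

namespace Literature.NumberTheory.Automorphic

/-! ## §1 Strong Hensel: a rootless `2 × 2` characteristic polynomial with integral determinant has integral trace, at any residue characteristic -/

section Completion

variable (K : Type*) [Field K] [NumberField K] (w : HeightOneSpectrum (𝓞 K))

/-- **`|det g| ≤ 1`, `χ_g` rootless ⇒ `|tr g| ≤ 1` in `K_w`, ANY residue characteristic** (`Valued` currency).  If `|t| > 1` (`t = tr g`, `d = det g`) then `x := 1 − 4d∕t²`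
has `|x − 1| = |4|·|d|∕|t|² < |4|`, so `x = s·s` (★ `exists_mul_self_eq_of_valued_sub_one_lt_four_adicCompletion`) and `r := (t + t s)∕2` satisfies `r² − t r + d = 0`.
The dyadic twin of ★ `valuation_trace_le_one_of_not_exists_isRoot` (`|2| = 1`, Hensel at radius `1`). [cite: Serre1979, Ch. XIV §4] [cite: Serre1979, Ch. II §4 Prop. 7] -/
theorem valued_trace_le_one_of_not_exists_isRoot_adicCompletion (g : Matrix (Fin 2) (Fin 2) (w.adicCompletion K))
    (hdet : Valued.v g.det ≤ 1) (hirr : ¬ ∃ x : w.adicCompletion K, (g.charpoly).IsRoot x) : Valued.v g.trace ≤ 1 := by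
  by_contra hgt
  rw [not_le] at hgt
  have h20 : (2 : w.adicCompletion K) ≠ 0 := by
    rw [← map_ofNat (algebraMap K (w.adicCompletion K)) 2]; exact (_root_.map_ne_zero _).2 (by norm_num)
  have h40 : (4 : w.adicCompletion K) ≠ 0 := by
    rw [← map_ofNat (algebraMap K (w.adicCompletion K)) 4]; exact (_root_.map_ne_zero _).2 (by norm_num)
  have ht0 : g.trace ≠ 0 := fun h => by rw [h, map_zero] at hgt; exact (not_lt.2 zero_le) hgt
  -- `|x − 1| = |4 d ∕ t²| < |4|`
  have hx : Valued.v ((1 - 4 * g.det / g.trace ^ 2) - 1) < Valued.v (4 : w.adicCompletion K) := by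
    rw [sub_sub_cancel_left, Valuation.map_neg, map_div₀, map_mul, map_pow]
    have ht1 : (1 : ℤᵐ⁰) < Valued.v g.trace ^ 2 := by
      calc (1 : ℤᵐ⁰) = 1 * 1 := (mul_one 1).symm
        _ < Valued.v g.trace * Valued.v g.trace := mul_lt_mul'' hgt hgt zero_le_one zero_le_one
        _ = Valued.v g.trace ^ 2 := (sq _).symm
    have hpos : (0 : ℤᵐ⁰) < Valued.v g.trace ^ 2 := lt_trans zero_lt_one ht1
    have h4v : (0 : ℤᵐ⁰) < Valued.v (4 : w.adicCompletion K) := zero_lt_iff.2 ((Valuation.ne_zero_iff _).2 h40)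
    rw [mul_div_assoc]
    calc Valued.v (4 : w.adicCompletion K) * (Valued.v g.det / Valued.v g.trace ^ 2)
        < Valued.v (4 : w.adicCompletion K) * 1 := by
          refine mul_lt_mul_of_pos_left ?_ h4v
          rw [div_lt_one₀ hpos]
          exact lt_of_le_of_lt hdet ht1
      _ = Valued.v (4 : w.adicCompletion K) := mul_one _
  obtain ⟨s, hs, -⟩ := Literature.NumberTheory.LocalFields.exists_mul_self_eq_of_valued_sub_one_lt_four_adicCompletion K w _ hx
  -- the root `(t + t s) ∕ 2`
  refine hirr ⟨(g.trace + g.trace * s) * 2⁻¹, ?_⟩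
  rw [Polynomial.IsRoot, Matrix.charpoly_fin_two]
  simp only [eval_add, eval_sub, eval_mul, eval_pow, eval_X, eval_C]
  have hts : (g.trace * s) ^ 2 = g.trace ^ 2 - 4 * g.det := by
    have ht2 : g.trace ^ 2 ≠ 0 := pow_ne_zero _ ht0
    rw [mul_pow, sq s, hs]
    field_simp
  have key : ((g.trace + g.trace * s) * 2⁻¹) ^ 2 - g.trace * ((g.trace + g.trace * s) * 2⁻¹) + g.det =
      ((g.trace * s) ^ 2 - (g.trace ^ 2 - 4 * g.det)) * 4⁻¹ := by
    field_simp
    ring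
  rw [key, hts, sub_self, zero_mul]

/-- **`ValuativeRel` reading** of `valued_trace_le_one_of_not_exists_isRoot_adicCompletion` — the drop-in replacement of ★ `valuation_trace_le_one_of_not_exists_isRoot (h2)`
at the completion of a number field, without the `|2| = 1` binder. [cite: Serre1979, Ch. XIV §4] -/
theorem valuation_trace_le_one_of_not_exists_isRoot_adicCompletion (g : Matrix (Fin 2) (Fin 2) (w.adicCompletion K))
    (hdet : valuation (w.adicCompletion K) g.det ≤ 1) (hirr : ¬ ∃ x : w.adicCompletion K, (g.charpoly).IsRoot x) :
    valuation (w.adicCompletion K) g.trace ≤ 1 :=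
  (v_le_one_iff_valuation_le_one _).1
    (valued_trace_le_one_of_not_exists_isRoot_adicCompletion K w g ((v_le_one_iff_valuation_le_one _).2 hdet) hirr)

/-- In `ℤᵐ⁰`: a product `a·a` is never `exp` of an odd integer. [folklore] -/
private theorem mul_self_ne_exp_odd' (a : ℤᵐ⁰) (m : ℤ) : a * a ≠ exp (2 * m + 1) := by
  intro h
  have ha0 : a ≠ 0 := by
    intro h0; rw [h0, mul_zero] at h; exact exp_ne_zero h.symm
  rw [← exp_log ha0, ← exp_add, exp_inj] at h
  omega

/-- **ODD `|t² − 4D|` WITH `|t| ≤ 1`, `|D| = 1` FORCES `|t² − 4D| < |4|`** (`Valued` currency, `K_w` any finite place): `|t²| = |t|²` and `|4D| = |2|²` are even powers of `exp`, so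
if they differ `|t² − 4D| = max` is even — contradiction —, hence `|t²| = |4|` and `|t² − 4D| ≤ |4|` with `≠` by parity. [cite: Omeara1963, §63A] [cite: Serre1979, Ch. XIV §4] -/
theorem valued_sub_lt_valued_four_of_odd {t D : w.adicCompletion K} (hD : Valued.v D = 1) {m : ℤ}
    (hodd : Valued.v (t ^ 2 - 4 * D) = exp (2 * m + 1)) : Valued.v (t ^ 2 - 4 * D) < Valued.v (4 : w.adicCompletion K) := by
  have h4D : Valued.v (4 * D) = Valued.v (2 : w.adicCompletion K) * Valued.v (2 : w.adicCompletion K) := by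
    rw [map_mul, hD, mul_one, show (4 : w.adicCompletion K) = 2 * 2 by norm_num, map_mul]
  have ht2 : Valued.v (t ^ 2) = Valued.v t * Valued.v t := by rw [map_pow, sq]
  by_cases hne : Valued.v (t ^ 2) = Valued.v (4 * D)
  · -- equal leading values: `|t² − 4D| ≤ |4D| = |4|`, and `≠` by parity
    have hle : Valued.v (t ^ 2 - 4 * D) ≤ Valued.v (4 * D) :=
      (Valuation.map_sub _ _ _).trans (max_le (le_of_eq hne) le_rfl)
    have h4 : Valued.v (4 * D) = Valued.v (4 : w.adicCompletion K) := by rw [map_mul, hD, mul_one]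
    rw [h4] at hle
    refine lt_of_le_of_ne hle fun heq => ?_
    rw [heq, show (4 : w.adicCompletion K) = 2 * 2 by norm_num, map_mul] at hodd
    exact mul_self_ne_exp_odd' _ _ hodd
  · -- distinct leading values: `|t² − 4D| = max`, an even power — contradiction
    exfalso
    have hmax : Valued.v (t ^ 2 - 4 * D) = max (Valued.v (t ^ 2)) (Valued.v (4 * D)) := by
      rw [sub_eq_add_neg, Valuation.map_add_of_distinct_val _ (by rwa [Valuation.map_neg]), Valuation.map_neg]
    rw [hmax] at hodd
    rcases le_total (Valued.v (t ^ 2)) (Valued.v (4 * D)) with h | h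
    · rw [max_eq_right h, h4D] at hodd; exact mul_self_ne_exp_odd' _ _ hodd
    · rw [max_eq_left h, ht2] at hodd; exact mul_self_ne_exp_odd' _ _ hodd

/-- **THE RADIUS FROM `disc∕4`**: `|D| = 1` and `|t² − 4D| = exp(2m+1)` odd give `N : ℕ` with `|(t² − 4D)∕4| = exp(−(2N+1))` (`N = j(γ)`, memo §0 table). [cite: Omeara1963, §63A]
[cite: Kottwitz1988, §2] -/
theorem exists_valued_disc_div_four_eq_exp_neg_odd {t D : w.adicCompletion K} (hD : Valued.v D = 1) {m : ℤ}
    (hodd : Valued.v (t ^ 2 - 4 * D) = exp (2 * m + 1)) :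
    ∃ N : ℕ, Valued.v ((t ^ 2 - 4 * D) / 4) = exp (-(2 * (N : ℤ) + 1)) := by
  have hlt := valued_sub_lt_valued_four_of_odd K w hD hodd
  have h40 : (4 : w.adicCompletion K) ≠ 0 := by
    rw [← map_ofNat (algebraMap K (w.adicCompletion K)) 4]; exact (_root_.map_ne_zero _).2 (by norm_num)
  have h20 : Valued.v (2 : w.adicCompletion K) ≠ 0 := by
    refine (Valuation.ne_zero_iff _).2 ?_
    rw [← map_ofNat (algebraMap K (w.adicCompletion K)) 2]; exact (_root_.map_ne_zero _).2 (by norm_num)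
  have h4 : Valued.v (4 : w.adicCompletion K) = exp (2 * log (Valued.v (2 : w.adicCompletion K))) := by
    rw [show (4 : w.adicCompletion K) = 2 * 2 by norm_num, map_mul, ← exp_log h20, ← exp_add, log_exp]; ring_nf
  rw [hodd, h4, exp_lt_exp] at hlt
  refine ⟨(log (Valued.v (2 : w.adicCompletion K)) - m - 1).toNat, ?_⟩
  rw [map_div₀, hodd, h4, ← exp_sub, exp_inj, Int.toNat_of_nonneg (by omega)]
  ring

end Completion

end Literature.NumberTheory.Automorphic

/-! ## §2 At the CM place: the packaged type-(2) data at the odd-discriminant rows, no `|2|` binder -/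

namespace Literature.NumberTheory.Automorphic.UnitaryGroup

section CM

variable (L : Type) [Field L] [NumberField L] [IsCMField L] (v : HeightOneSpectrum (𝓞 ↥(maximalRealSubfield L)))
  (w : PlacesOver L v) (hw : IsCMField.complexConj L • w.1 = w.1)

include hw in
/-- **THE TYPE-(2) DATA OF `γ ∈ U₂` FROM `hirr` AT AN ODD-DISCRIMINANT ROW, ANY RESIDUE CHARACTERISTIC**: if `χ_{γ,w}` has no root in `L_w` and `|tr² − 4det|_w = exp(2m+1)` is
ODD (rows (T) and (W-odd) of the M6 memo; at a wild unit-discriminant row the order is even and this theorem does not apply), then `tr γ_w ∈ 𝒪_w` (§1 with `|det γ_w| = 1`,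
★ `valuation_det_eq_one_of_mem`) and `|(tr² − 4det)∕4|_w = exp(−(2N+1))` for some `N : ℕ` (§1 `exists_valued_disc_div_four_eq_exp_neg_odd`) — the `|2|`-free twin of ★
`typeTwo_sideConditions_of_not_exists_isRoot`, with `disc` read through `disc∕4` (so that `N = j(γ)` is the radius of the fixed ball in both rows).
[cite: Rogawski1990, §3.6 p. 31] [cite: Kottwitz1988, §2] [cite: Omeara1963, §63A] -/
theorem typeTwo_sideConditions_of_not_exists_isRoot_of_odd
    (γ : ((cmDatum L 2 (Matrix.of fun i j : Fin 2 => if i.val + j.val + 1 = 2 then (1 : L) else 0)).Local v))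
    (hirr : ¬ ∃ x : (w.1.adicCompletion L), (((((localNonsplitEquiv (IsCMField.complexConj L) (Matrix.of fun i j : Fin 2 => if i.val + j.val + 1 = 2 then (1 : L) else 0) (IsCMField.complexConj_ne_one L) w hw) γ : ↥(unitaryGroupOfForm (galAdicCompletionMap (L := L) (IsCMField.complexConj L) hw) (placeForm (Matrix.of fun i j : Fin 2 => if i.val + j.val + 1 = 2 then (1 : L) else 0) w.1))) : GL (Fin 2) (w.1.adicCompletion L)) : Matrix (Fin 2) (Fin 2) (w.1.adicCompletion L)).charpoly).IsRoot x)
    {m : ℤ} (hodd : Valued.v (((((localNonsplitEquiv (IsCMField.complexConj L) (Matrix.of fun i j : Fin 2 => if i.val + j.val + 1 = 2 then (1 : L) else 0) (IsCMField.complexConj_ne_one L) w hw) γ : ↥(unitaryGroupOfForm (galAdicCompletionMap (L := L) (IsCMField.complexConj L) hw) (placeForm (Matrix.of fun i j : Fin 2 => if i.val + j.val + 1 = 2 then (1 : L) else 0) w.1))) : GL (Fin 2) (w.1.adicCompletion L)) : Matrix (Fin 2) (Fin 2) (w.1.adicCompletion L)).trace ^ 2 - 4 * ((((localNonsplitEquiv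 (IsCMField.complexConj L) (Matrix.of fun i j : Fin 2 => if i.val + j.val + 1 = 2 then (1 : L) else 0) (IsCMField.complexConj_ne_one L) w hw) γ : ↥(unitaryGroupOfForm (galAdicCompletionMap (L := L) (IsCMField.complexConj L) hw) (placeForm (Matrix.of fun i j : Fin 2 => if i.val + j.val + 1 = 2 then (1 : L) else 0) w.1))) : GL (Fin 2) (w.1.adicCompletion L)) : Matrix (Fin 2) (Fin 2) (w.1.adicCompletion L)).det) = exp (2 * m + 1)) :
    ((((localNonsplitEquiv (IsCMField.complexConj L) (Matrix.of fun i j : Fin 2 => if i.val + j.val + 1 = 2 then (1 : L) else 0) (IsCMField.complexConj_ne_one L) w hw) γ : ↥(unitaryGroupOfForm (galAdicCompletionMap (L := L) (IsCMField.complexConj L) hw) (placeForm (Matrix.of fun i j : Fin 2 => if i.val + j.val + 1 = 2 then (1 : L) else 0) w.1))) : GL (Fin 2) (w.1.adicCompletion L)) : Matrix (Fin 2) (Fin 2) (w.1.adicCompletion L)).trace ∈ 𝒪[(w.1.adicCompletion L)] ∧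
      ∃ N : ℕ, Valued.v ((((((localNonsplitEquiv (IsCMField.complexConj L) (Matrix.of fun i j : Fin 2 => if i.val + j.val + 1 = 2 then (1 : L) else 0) (IsCMField.complexConj_ne_one L) w hw) γ : ↥(unitaryGroupOfForm (galAdicCompletionMap (L := L) (IsCMField.complexConj L) hw) (placeForm (Matrix.of fun i j : Fin 2 => if i.val + j.val + 1 = 2 then (1 : L) else 0) w.1))) : GL (Fin 2) (w.1.adicCompletion L)) : Matrix (Fin 2) (Fin 2) (w.1.adicCompletion L)).trace ^ 2 - 4 * ((((localNonsplitEquiv (IsCMField.complexConj L) (Matrix.of fun i j : Fin 2 => if i.val + j.val + 1 = 2 then (1 : L) else 0) (IsCMField.complexConj_ne_one L) w hw) γ : ↥(unitaryGroupOfForm (galAdicCompletionMap (L := L) (IsCMField.complexConj L) hw) (placeForm (Matrix.of fun i j : Fin 2 => if i.val + j.val + 1 = 2 then (1 : L) else 0) w.1))) : GL (Fin 2) (w.1.adicCompletion L)) : Matrix (Fin 2) (Fin 2) (w.1.adicCompletion L)).det) / 4) =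
        exp (-(2 * (N : ℤ) + 1)) := by
  have hdet := valuation_det_eq_one_of_mem L v w hw ((localNonsplitEquiv (IsCMField.complexConj L) (Matrix.of fun i j : Fin 2 => if i.val + j.val + 1 = 2 then (1 : L) else 0) (IsCMField.complexConj_ne_one L) w hw) γ)
  have hdet' : Valued.v ((((localNonsplitEquiv (IsCMField.complexConj L) (Matrix.of fun i j : Fin 2 => if i.val + j.val + 1 = 2 then (1 : L) else 0) (IsCMField.complexConj_ne_one L) w hw) γ : ↥(unitaryGroupOfForm (galAdicCompletionMap (L := L) (IsCMField.complexConj L) hw) (placeForm (Matrix.of fun i j : Fin 2 => if i.val + j.val + 1 = 2 then (1 : L) else 0) w.1))) : GL (Fin 2) (w.1.adicCompletion L)) : Matrix (Fin 2) (Fin 2) (w.1.adicCompletion L)).det = 1 :=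
    (v_eq_one_iff_valuation_eq_one _).2 hdet
  have htr := valued_trace_le_one_of_not_exists_isRoot_adicCompletion L w.1 _ hdet'.le hirr
  obtain ⟨N, hN⟩ := exists_valued_disc_div_four_eq_exp_neg_odd L w.1 hdet' hodd
  exact ⟨(Valuation.mem_integer_iff _ _).2 ((v_le_one_iff_valuation_le_one _).1 htr), N, hN⟩

end CM

end Literature.NumberTheory.Automorphic.UnitaryGroup

end
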